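import Summits.HubbardSuperconductivity.HubbardSuperconductivity.Theses.InfiniteVolumeFirst
import Summits.HubbardSuperconductivity.HubbardSuperconductivity.Theorems.InfiniteVolumeFirstTightnessExchange
import Summits.HubbardSuperconductivity.HubbardSuperconductivity.Theorems.InfiniteVolumeFirstNoNormalLimitStateStubWindowFloorAtom

/-!
# Crux `NoInfraredPileUp` (stmt-HubbardSuperconductivity-18534, route `InfiniteVolumeFirst`) —
# mass transfer I: TIGHT WINDOWS ⇒ THE CONDENSATE DENSITY PASSES TO THE LIMIT

Model-free harmonic analysis on the tori `(ℤ/Lℤ)²` (no Hamiltonian). For a family `ψ_L` of torus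
Fock vectors normalised at the even sides write `S_L(m)` for the `d`-wave pair structure factor
(`pairStructureFactor`), `n_L = S_L(0)/L² = |Λ_L|⁻² Σ_{x,y∈Λ_L} G_L(x,y)` for the torus condensate
(long-range-order) density, `T_ε(L) = Σ_{m≠0,|q_m|≤ε} S_L(m)` for the window tail,
`C_L(x) = L⁻² Σ_y G_L(x+y,y)` for the translation-averaged pair correlation and, for a pointwise
limit `C` of `C_{L_j}` along even sides `L_j ↑ ∞`, `atom(C) = liminf_R R⁻⁴ Σ_{x,y∈[0,R)²} C(x−y)`
for its Bochner atom (the ODLRO density of the infinite-volume limit state).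

* `closedWindow_eq_zero_add_window` — `Σ_{|q_m|≤ε} S_L(m) = S_L(0) + T_ε(L)`;
* `lroSeq_le_boxAvg` — `n_L ≤ R⁻⁴ Σ_{x,y∈[0,R)²} C_L(x−y)` at every side and block scale (the
  `m = 0` term of block Plancherel), whence `atom(C) ≥ limsup_j n_{L_j}` ALWAYS;
* `boxAvg_ge_window` — `(1 − 4εR)(n_L + T_ε(L)/L²) ≤ R⁻⁴ Σ C_L(x−y)` (windowed Fejér LOWER bound
  `windowSum_le_boxAvg` with the zero mode split off);
* `abs_boxAvg_le`, `abs_limit_corrAvg_le` — a priori bounds (`|C| ≤ C_d²`, block averages `≤ C_d²`);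
* `stub_lroSeqTendstoAtom_of_tight` (registered stub) — if the windows of `ψ` are TIGHT
  (`∀ η ∃ ε, L₀ ∀ even L ≥ L₀: T_ε(L) ≤ ηL²`, the conclusion of the crux for `ψ`), then along EVERY
  strictly increasing sequence of even sides on which `C_L → C` pointwise, `n_{L_j} → atom(C)`:
  no `d`-wave condensate mass is gained or lost in the infinite-volume limit (`≤` from the Fejér
  upper bound `tightnessExchange_fejer_bound` and the tight window, `≥` from `lroSeq_le_boxAvg`).

The converse (non-tight windows force a GAIN of mass in some limit) and the resulting equivalences
are in `InfiniteVolumeFirstNoInfraredPileUpMassTransfer.lean`.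

Sources: T. Kennedy, E. H. Lieb, B. S. Shastry, PRL **61** (1988) 2582 (Fourier modes of an order
operator, Parseval sum rule); J. Fröhlich, B. Simon, T. Spencer, CMP **50** (1976) 79, §3;
S. Friedli, Y. Velenik (2017) §3.7.2, §10.4; E. M. Stein, R. Shakarchi, *Fourier Analysis* (2003)
Ch. 2 (Fejér kernel); P. Billingsley, *Convergence of Probability Measures* (1999) §1.2
(portmanteau at an atom). Folklore finite-dimensional statements; no definition and no named fact
is introduced.
-/

noncomputable section

-- the mandated namespace `Summit.<Summit>.<Problem>.Theorems` repeats `HubbardSuperconductivity`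
-- (single-problem summit, D-0017), which the `dupNamespace` linter flags on every declaration
set_option linter.dupNamespace false

namespace Summit.HubbardSuperconductivity.HubbardSuperconductivity.Theorems.NoInfraredPileUp

open Literature.MathematicalPhysics.QuantumLattice Literature.Probability.LatticeModels Matrix Finset
  Filter
open Summit.HubbardSuperconductivity.HubbardSuperconductivity.Theorems
open scoped ComplexConjugate ComplexOrder Topology

/-! ### Finite-side inequalities -/

/-- The closed momentum window splits off its zero mode:
`Σ_{|q_m| ≤ ε} S_L(m) = S_L(0) + Σ_{m ≠ 0, |q_m| ≤ ε} S_L(m)` (`|q_0| = 0`).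
Kennedy–Lieb–Shastry, PRL 61 (1988) 2582. [folklore] -/
theorem closedWindow_eq_zero_add_window {L : ℕ} [NeZero L] (ε : ℝ)
    (φ : Fock (Orb (FermionTorus 2 L))) :
    (∑ m : TorusSite 2 L, if momentumNormSq L m ≤ ε ^ 2 then
        pairStructureFactor dWaveFormFactor L φ m else 0) =
      pairStructureFactor dWaveFormFactor L φ 0 +
        ∑ m : TorusSite 2 L, if m ≠ 0 ∧ momentumNormSq L m ≤ ε ^ 2 then
          pairStructureFactor dWaveFormFactor L φ m else 0 := by
  classical
  have h : ∀ m : TorusSite 2 L, (if momentumNormSq L m ≤ ε ^ 2 then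
      pairStructureFactor dWaveFormFactor L φ m else 0) =
      (if m = 0 then pairStructureFactor dWaveFormFactor L φ m else 0) +
        (if m ≠ 0 ∧ momentumNormSq L m ≤ ε ^ 2 then
          pairStructureFactor dWaveFormFactor L φ m else 0) := by
    intro m
    by_cases hm : m = 0
    · subst hm
      simp [sq_nonneg ε]
    · simp [hm]
  rw [Finset.sum_congr rfl fun m _ => h m, Finset.sum_add_distrib, Finset.sum_ite_eq']
  simp

/-- **The zero mode is below every block average.** At the side `L = n + 1` and any block scale
`R > 0`, for ANY vector: `|Λ_L|⁻² Σ_{x,y∈Λ_L} G_L(x,y) ≤ R⁻⁴ Σ_{x,y∈[0,R)²} C_L(x−y)` — the box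
double sum is block pair coherence, whose block-Plancherel expansion has nonnegative terms and whose
`m = 0` term is `R⁴ S_L(0) = R⁴ L² · LRO_L` (`windowSum_le_boxAvg` at `ε = 0`).
Kennedy–Lieb–Shastry, PRL 61 (1988) 2582; Friedli–Velenik (2017) §10.4. [folklore] -/
theorem lroSeq_le_boxAvg (ψ : ∀ L, Fock (Orb (FermionTorus 2 L))) (n R : ℕ) (hR : 0 < R) :
    (∑ x ∈ halfOpenBox 2 (n + 1), ∑ y ∈ halfOpenBox 2 (n + 1),
        torusPullback (pairFieldCorr dWaveFormFactor ψ) (n + 1) x y) /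
          ((halfOpenBox 2 (n + 1)).card : ℝ) ^ 2 ≤
      (∑ x ∈ halfOpenBox 2 R, ∑ y ∈ halfOpenBox 2 R,
        (∑ w ∈ halfOpenBox 2 (n + 1),
          torusPullback (pairFieldCorr dWaveFormFactor ψ) (n + 1) (x - y + w) w) /
            ((n + 1 : ℕ) : ℝ) ^ 2) / (R : ℝ) ^ 4 := by
  classical
  have h := NoNormalLimitState.windowSum_le_boxAvg ψ n R hR (le_refl (0 : ℝ))
  rw [show (1 - 4 * (0 : ℝ) * R) = 1 by ring, one_mul] at h
  refine le_trans ?_ h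
  -- `LRO_L = S_L(0) / L²` and `S_L(0)` is one nonnegative term of the closed window at `ε = 0`
  have hL : (0 : ℝ) < ((n + 1 : ℕ) : ℝ) := by positivity
  have hzero : (∑ x ∈ halfOpenBox 2 (n + 1), ∑ y ∈ halfOpenBox 2 (n + 1),
      torusPullback (pairFieldCorr dWaveFormFactor ψ) (n + 1) x y) /
        ((halfOpenBox 2 (n + 1)).card : ℝ) ^ 2 =
      pairStructureFactor dWaveFormFactor (n + 1) (ψ (n + 1)) 0 / ((n + 1 : ℕ) : ℝ) ^ 2 := by
    rw [torusLROSeq_pairFieldCorr_succ, pairStructureFactor_zero]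
    field_simp
  rw [hzero]
  refine div_le_div_of_nonneg_right ?_ (by positivity)
  have hterm : pairStructureFactor dWaveFormFactor (n + 1) (ψ (n + 1)) 0 =
      (if momentumNormSq (n + 1) (0 : TorusSite 2 (n + 1)) ≤ (0 : ℝ) ^ 2 then
        pairStructureFactor dWaveFormFactor (n + 1) (ψ (n + 1)) 0 else 0) := by
    simp
  rw [hterm]
  exact Finset.single_le_sum (f := fun m : TorusSite 2 (n + 1) =>
      if momentumNormSq (n + 1) m ≤ (0 : ℝ) ^ 2 then
        pairStructureFactor dWaveFormFactor (n + 1) (ψ (n + 1)) m else 0)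
    (fun m _ => by
      split_ifs
      · exact pairStructureFactor_nonneg _ _ _ _
      · exact le_rfl)
    (Finset.mem_univ _)

/-- **Windowed Fejér lower bound with the zero mode split off.** At the side `L = n + 1`, block scale
`R > 0` and window `ε ≥ 0` with `4εR ≤ 1`, for ANY vector:
`(1 − 4εR) · (LRO_L + L⁻² Σ_{m≠0,|q_m|≤ε} S_L(m)) ≤ R⁻⁴ Σ_{x,y∈[0,R)²} C_L(x−y)`
(`windowSum_le_boxAvg` and `closedWindow_eq_zero_add_window`).
Kennedy–Lieb–Shastry, PRL 61 (1988) 2582; Stein–Shakarchi Ch. 2. [folklore] -/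
theorem boxAvg_ge_window (ψ : ∀ L, Fock (Orb (FermionTorus 2 L))) (n R : ℕ) (hR : 0 < R)
    {ε : ℝ} (hε : 0 ≤ ε) :
    (1 - 4 * ε * R) * ((∑ x ∈ halfOpenBox 2 (n + 1), ∑ y ∈ halfOpenBox 2 (n + 1),
        torusPullback (pairFieldCorr dWaveFormFactor ψ) (n + 1) x y) /
          ((halfOpenBox 2 (n + 1)).card : ℝ) ^ 2 +
        (∑ m : TorusSite 2 (n + 1), if m ≠ 0 ∧ momentumNormSq (n + 1) m ≤ ε ^ 2 then
            pairStructureFactor dWaveFormFactor (n + 1) (ψ (n + 1)) m else 0) /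
          ((n + 1 : ℕ) : ℝ) ^ 2) ≤
      (∑ x ∈ halfOpenBox 2 R, ∑ y ∈ halfOpenBox 2 R,
        (∑ w ∈ halfOpenBox 2 (n + 1),
          torusPullback (pairFieldCorr dWaveFormFactor ψ) (n + 1) (x - y + w) w) /
            ((n + 1 : ℕ) : ℝ) ^ 2) / (R : ℝ) ^ 4 := by
  classical
  have h := NoNormalLimitState.windowSum_le_boxAvg ψ n R hR hε
  rw [closedWindow_eq_zero_add_window] at h
  have hzero : (∑ x ∈ halfOpenBox 2 (n + 1), ∑ y ∈ halfOpenBox 2 (n + 1),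
      torusPullback (pairFieldCorr dWaveFormFactor ψ) (n + 1) x y) /
        ((halfOpenBox 2 (n + 1)).card : ℝ) ^ 2 =
      pairStructureFactor dWaveFormFactor (n + 1) (ψ (n + 1)) 0 / ((n + 1 : ℕ) : ℝ) ^ 2 := by
    rw [torusLROSeq_pairFieldCorr_succ, pairStructureFactor_zero]
    have hL : (0 : ℝ) < ((n + 1 : ℕ) : ℝ) := by positivity
    field_simp
  rw [hzero, ← add_div]
  exact h

/-- Box averages of a function bounded by `B ≥ 0` are bounded by `B`:
`|R⁻⁴ Σ_{x,y∈[0,R)²} C(x−y)| ≤ B` (junk value `0` at `R = 0`). [folklore] -/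
theorem abs_boxAvg_le {C : Site 2 → ℝ} {B : ℝ} (hB : 0 ≤ B) (hC : ∀ x, |C x| ≤ B) (R : ℕ) :
    |(∑ x ∈ halfOpenBox 2 R, ∑ y ∈ halfOpenBox 2 R, C (x - y)) / ((R : ℕ) : ℝ) ^ 4| ≤ B := by
  rw [abs_div, abs_of_nonneg (by positivity : (0 : ℝ) ≤ ((R : ℕ) : ℝ) ^ 4)]
  rcases Nat.eq_zero_or_pos R with rfl | hRpos
  · simpa using hB
  · rw [div_le_iff₀ (by positivity)]
    calc |∑ x ∈ halfOpenBox 2 R, ∑ y ∈ halfOpenBox 2 R, C (x - y)|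
        ≤ ∑ x ∈ halfOpenBox 2 R, |∑ y ∈ halfOpenBox 2 R, C (x - y)| :=
          Finset.abs_sum_le_sum_abs _ _
      _ ≤ ∑ x ∈ halfOpenBox 2 R, ∑ y ∈ halfOpenBox 2 R, |C (x - y)| :=
          Finset.sum_le_sum fun x _ => Finset.abs_sum_le_sum_abs _ _
      _ ≤ ∑ x ∈ halfOpenBox 2 R, ∑ y ∈ halfOpenBox 2 R, B :=
          Finset.sum_le_sum fun x _ => Finset.sum_le_sum fun y _ => hC _
      _ = B * ((R : ℕ) : ℝ) ^ 4 := by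
          rw [Finset.sum_const, Finset.sum_const, card_halfOpenBox, smul_smul, nsmul_eq_mul]
          push_cast
          ring

/-- A pointwise limit of the translation-averaged pair correlations of states normalised at the
(even) sides of the subsequence is bounded by `C_d²` (`tightnessExchange_abs_corrAvg_le` and
closedness of `[-C_d², C_d²]`). Scalapino, Phys. Rep. 250 (1995) 329, §2. [folklore] -/
theorem abs_limit_corrAvg_le (ψ : ∀ L, Fock (Orb (FermionTorus 2 L))) (Ls : ℕ → ℕ)
    (hnorm : ∀ j, star (ψ (Ls j)) ⬝ᵥ ψ (Ls j) = 1) (C : Site 2 → ℝ)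
    (hconv : ∀ x : Site 2, Tendsto (fun j : ℕ => (∑ y ∈ halfOpenBox 2 (Ls j),
        torusPullback (pairFieldCorr dWaveFormFactor ψ) (Ls j) (x + y) y) / ((Ls j : ℕ) : ℝ) ^ 2)
      atTop (𝓝 (C x))) (x : Site 2) :
    |C x| ≤ (∑ e ∈ insert (0 : Site 2) unitSteps,
        ‖((dWaveFormFactor e / Real.sqrt 2 : ℝ) : ℂ)‖ * 2) ^ 2 := by
  refine abs_le.2 (isClosed_Icc.mem_of_tendsto (hconv x) (Eventually.of_forall fun j => ?_))
  exact abs_le.1 (tightnessExchange_abs_corrAvg_le ψ (Ls j) (hnorm j) x)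

/-! ### Tight windows: the condensate density passes to the limit -/

/-- **Tightness ⇒ conservation of condensate mass** (registered stub
`stub_lroSeqTendstoAtom_of_tight` of crux stmt-HubbardSuperconductivity-18534). Let `ψ_L` be
normalised at the even sides and
let its small-momentum windows be tight (`∀ η ∃ ε, L₀ ∀ even L ≥ L₀: Σ_{m≠0,|q_m|≤ε} S_L(m) ≤ ηL²`,
the conclusion of `NoInfraredPileUp` for this family). Then along EVERY strictly increasing sequence
of even sides on which the translation-averaged pair correlations converge pointwise to `C`, the
torus condensate densities converge to the Bochner atom of the limit:
`|Λ_{L_j}|⁻² Σ_{x,y} G_{L_j}(x,y) → liminf_R R⁻⁴ Σ_{x,y∈[0,R)²} C(x−y)`.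
(`≥`: the zero mode is below every block average, `lroSeq_le_boxAvg`; `≤`: the Fejér bound
`tightnessExchange_fejer_bound` with the tight window.) Portmanteau at the atom `{0}` of the pair
spectral measures; Kennedy–Lieb–Shastry, PRL 61 (1988) 2582; Friedli–Velenik (2017) §10.4;
Billingsley (1999) §1.2. [folklore] -/
theorem stub_lroSeqTendstoAtom_of_tight :
    ∀ (ψ : ∀ L, Fock (Orb (FermionTorus 2 L))), (∀ L, Even L → star (ψ L) ⬝ᵥ ψ L = 1) →
      (∀ η : ℝ, 0 < η → ∃ ε : ℝ, 0 < ε ∧ ∃ L₀ : ℕ, ∀ (L : ℕ) [NeZero L], Even L → L₀ ≤ L →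
          (∑ m : Fin 2 → ZMod L, if m ≠ 0 ∧ momentumNormSq L m ≤ ε ^ 2 then
              pairStructureFactor dWaveFormFactor L (ψ L) m else 0) ≤ η * (L : ℝ) ^ 2) →
        ∀ (Ls : ℕ → ℕ) (C : Site 2 → ℝ), StrictMono Ls → (∀ j, Even (Ls j)) →
          (∀ x : Site 2, Tendsto (fun j : ℕ => (∑ y ∈ halfOpenBox 2 (Ls j),
              torusPullback (pairFieldCorr dWaveFormFactor ψ) (Ls j) (x + y) y) /
                ((Ls j : ℕ) : ℝ) ^ 2) atTop (𝓝 (C x))) →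
            Tendsto (fun j : ℕ => (∑ x ∈ halfOpenBox 2 (Ls j), ∑ y ∈ halfOpenBox 2 (Ls j),
                torusPullback (pairFieldCorr dWaveFormFactor ψ) (Ls j) x y) /
                  ((halfOpenBox 2 (Ls j)).card : ℝ) ^ 2) atTop
              (𝓝 (liminf (fun R : ℕ => (∑ x ∈ halfOpenBox 2 R, ∑ y ∈ halfOpenBox 2 R,
                C (x - y)) / ((R : ℕ) : ℝ) ^ 4) atTop)) := by
  intro ψ hnorm htight Ls C hLs hLs_even hconv
  -- the constant `C_d²`
  obtain ⟨B, hB⟩ : ∃ B : ℝ, B = (∑ e ∈ insert (0 : Site 2) unitSteps,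
      ‖((dWaveFormFactor e / Real.sqrt 2 : ℝ) : ℂ)‖ * 2) ^ 2 := ⟨_, rfl⟩
  have hB0 : 0 ≤ B := by rw [hB]; positivity
  -- the long-range-order sequence
  obtain ⟨u, hu⟩ : ∃ u : ℕ → ℝ, ∀ L, u L = (∑ x ∈ halfOpenBox 2 L, ∑ y ∈ halfOpenBox 2 L,
      torusPullback (pairFieldCorr dWaveFormFactor ψ) L x y) / ((halfOpenBox 2 L).card : ℝ) ^ 2 :=
    ⟨_, fun _ => rfl⟩
  -- the translation-averaged pair correlations
  obtain ⟨Cavg, hCavg⟩ : ∃ Cavg : ℕ → Site 2 → ℝ, ∀ L x, Cavg L x =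
      (∑ y ∈ halfOpenBox 2 L, torusPullback (pairFieldCorr dWaveFormFactor ψ) L (x + y) y) /
        ((L : ℕ) : ℝ) ^ 2 := ⟨_, fun _ _ => rfl⟩
  -- the block averages of the limit
  obtain ⟨b, hb⟩ : ∃ b : ℕ → ℝ, ∀ R, b R = (∑ x ∈ halfOpenBox 2 R, ∑ y ∈ halfOpenBox 2 R,
      C (x - y)) / ((R : ℕ) : ℝ) ^ 4 := ⟨_, fun _ => rfl⟩
  have hgoal : (fun j : ℕ => (∑ x ∈ halfOpenBox 2 (Ls j), ∑ y ∈ halfOpenBox 2 (Ls j),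
      torusPullback (pairFieldCorr dWaveFormFactor ψ) (Ls j) x y) /
        ((halfOpenBox 2 (Ls j)).card : ℝ) ^ 2) = fun j => u (Ls j) := funext fun j => (hu _).symm
  have hbfun : (fun R : ℕ => (∑ x ∈ halfOpenBox 2 R, ∑ y ∈ halfOpenBox 2 R, C (x - y)) /
      ((R : ℕ) : ℝ) ^ 4) = b := funext fun R => (hb R).symm
  rw [hgoal, hbfun]
  -- a priori bounds
  have hCbd : ∀ x, |C x| ≤ B := fun x =>
    hB ▸ abs_limit_corrAvg_le ψ Ls (fun j => hnorm _ (hLs_even j)) C hconv x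
  have hb_bdd : ∀ R, |b R| ≤ B := fun R => by rw [hb]; exact abs_boxAvg_le hB0 hCbd R
  have hb_low : ∀ R, -B ≤ b R := fun R => (abs_le.1 (hb_bdd R)).1
  have hb_up : ∀ R, b R ≤ B := fun R => (abs_le.1 (hb_bdd R)).2
  -- the block averages of `C_{L_j}` converge to those of `C`
  have hconv' : ∀ x : Site 2, Tendsto (fun j => Cavg (Ls j) x) atTop (𝓝 (C x)) := fun x => by
    simpa only [hCavg] using hconv x
  have hbj : ∀ R : ℕ, Tendsto (fun j => (∑ x ∈ halfOpenBox 2 R, ∑ y ∈ halfOpenBox 2 R,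
      Cavg (Ls j) (x - y)) / ((R : ℕ) : ℝ) ^ 4) atTop (𝓝 (b R)) := fun R => by
    rw [hb]
    exact (tendsto_finsetSum _ fun x _ => tendsto_finsetSum _ fun y _ => hconv' (x - y)).div_const _
  -- sides are eventually positive
  have hev1 : ∀ L₀ : ℕ, ∀ᶠ j in atTop, L₀ ≤ Ls j := fun L₀ => hLs.tendsto_atTop.eventually_ge_atTop L₀
  set a := liminf b atTop with ha
  rw [tendsto_order]
  refine ⟨fun a' ha' => ?_, fun a' ha' => ?_⟩
  · -- lower estimate: `u (Ls j) > a'` eventually, from the Fejér UPPER bound and tightness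
    obtain ⟨η, hη, hηa⟩ : ∃ η : ℝ, 0 < η ∧ a' + 5 * η ≤ a := ⟨(a - a') / 5, by linarith, by linarith⟩
    obtain ⟨ε, hε, L₀, hL₀⟩ := htight η hη
    -- the Fejér tail vanishes as `R → ∞`
    have htail : Tendsto (fun R : ℕ => 2 * Real.pi ^ 2 * B / ((R : ℝ) ^ 2 * ε ^ 2)) atTop
        (𝓝 0) := by
      refine tendsto_const_nhds.div_atTop ?_
      exact ((tendsto_pow_atTop two_ne_zero).comp tendsto_natCast_atTop_atTop).atTop_mul_const
        (pow_pos hε 2)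
    -- `b R > a - η` eventually in `R`
    have hbR : ∀ᶠ R in atTop, a - η < b R :=
      eventually_lt_of_lt_liminf (by rw [← ha]; linarith) (isBoundedUnder_of ⟨-B, hb_low⟩)
    obtain ⟨R, hRtail, hRb, hR1⟩ := ((htail.eventually_le_const hη).and (hbR.and
      (eventually_ge_atTop 1))).exists
    have hRpos : 0 < R := hR1
    -- pass to `j`
    have hbjR : ∀ᶠ j in atTop, a - 2 * η < (∑ x ∈ halfOpenBox 2 R, ∑ y ∈ halfOpenBox 2 R,
        Cavg (Ls j) (x - y)) / ((R : ℕ) : ℝ) ^ 4 :=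
      (hbj R).eventually (lt_mem_nhds (by linarith))
    filter_upwards [hbjR, hev1 (max L₀ 1)] with j hj hjL
    obtain ⟨n, hn⟩ : ∃ n, Ls j = n + 1 := ⟨Ls j - 1, by omega⟩
    have hevn : Even (n + 1) := hn ▸ hLs_even j
    have hψn : star (ψ (n + 1)) ⬝ᵥ ψ (n + 1) = 1 := hnorm (n + 1) hevn
    have hwin := hL₀ (n + 1) hevn (by omega)
    have hwin' : (∑ m : TorusSite 2 (n + 1), if m ≠ 0 ∧ momentumNormSq (n + 1) m ≤ ε ^ 2 then
        pairStructureFactor dWaveFormFactor (n + 1) (ψ (n + 1)) m else 0) /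
          ((n + 1 : ℕ) : ℝ) ^ 2 ≤ η := by rwa [div_le_iff₀ (by positivity)]
    have hf := tightnessExchange_fejer_bound ψ n hψn R hRpos ε hε
    rw [← hB, ← hu] at hf
    rw [hn] at hj ⊢
    simp only [hCavg] at hj
    linarith
  · -- upper estimate: `u (Ls j) < a'` eventually, from the zero mode below a good block average
    obtain ⟨η, hη, hηa⟩ : ∃ η : ℝ, 0 < η ∧ a + 3 * η ≤ a' := ⟨(a' - a) / 3, by linarith, by linarith⟩
    have hfreq : ∃ᶠ R in atTop, b R < a + η :=
      frequently_lt_of_liminf_lt (isCoboundedUnder_ge_of_le atTop hb_up) (by rw [← ha]; linarith)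
    obtain ⟨R, hRb, hR1⟩ := (hfreq.and_eventually (eventually_ge_atTop 1)).exists
    have hRpos : 0 < R := hR1
    have hbjR : ∀ᶠ j in atTop, (∑ x ∈ halfOpenBox 2 R, ∑ y ∈ halfOpenBox 2 R,
        Cavg (Ls j) (x - y)) / ((R : ℕ) : ℝ) ^ 4 < a + 2 * η :=
      (hbj R).eventually (gt_mem_nhds (by linarith))
    filter_upwards [hbjR, hev1 1] with j hj hjL
    obtain ⟨n, hn⟩ : ∃ n, Ls j = n + 1 := ⟨Ls j - 1, by omega⟩
    have hz := lroSeq_le_boxAvg ψ n R hRpos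
    rw [← hu] at hz
    rw [hn] at hj ⊢
    simp only [hCavg] at hj
    linarith

end Summit.HubbardSuperconductivity.HubbardSuperconductivity.Theorems.NoInfraredPileUp

end
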